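import Mathlib
import HarnessLib
import Summits.ABC.ABC.Theses.CongruentialReceptacle
import Summits.ABC.ABC.Theorems.CongruentialReceptacleAssembly
import Summits.ABC.ABC.Theorems.CongruentialReceptacleQuarterWindowGivesCrux

/-!
# Crux `CompactBalanceTransfer` (stmt-ABC-1725) — negative-side structure lemmas

Negative-lane support written by the crux disprover (`refuter-cdisprove-stmt-ABC-1725-0`, 2026-08-16) for the crux
`CompactBalanceTransfer := H → ABC` of route CongruentialReceptacle, where
`H := ∀ κ > 0, ∀ ε > 0, ∃ C, ∀ abc-triples, κc ≤ a → κc ≤ b → c < C · rad(abc)^(1+ε)`.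

* `not_compactBalanceTransfer_iff` : `¬ crux ↔ (H ∧ ¬ ABC)` — every refutation of the crux contains a refutation of
  ABC (the disprover's formal reason for attacking the picked line's stub instead of the crux);
* (the cell `min(a,b) ≥ κc` is EMPTY for `κ > 1/2` — already in the tree as
  `Summit.ABC.ABC.Theorems.BalancedFreySzpiro.Negative.cell_empty_of_half_lt` — so `H` has content only for `κ ≤ 1/2`);
* `abc_of_quarterBalanced_of_compactBalanceTransfer` : `crux → (abc on the single cell min(a,b) ≥ c/4) → ABC` — the
  quantifier `∀ κ` in `H` is spurious: by the squaring descent already in the tree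
  (`quarterWindowGivesCrux_proof`, `balancedABC_of_balancedFreySzpiro`) the instance `κ = 1/4` of `H` gives all of
  `H`; with the trivial converse this is `¬ crux ↔ (QuarterBalancedABC ∧ ¬ ABC)`
  (`not_compactBalanceTransfer_iff_quarter`): the crux is exactly "abc on the cell `min(a,b) ≥ c/4` implies abc".

No `def`s (statements inlined); unconditional; axioms standard.
-/

-- `Summit.<Summit>.<Problem>`: for the single-conjunct summit `ABC` the duplicate `ABC.ABC` is mandated.
set_option linter.dupNamespace false

namespace Summit.ABC.ABC.Theorems.CompactBalanceTransfer.Negative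

open Literature.NumberTheory.DiophantineGeometry
open Summit.ABC.ABC.Theses.CongruentialReceptacle

/-- `¬ crux ↔ H ∧ ¬ABC`: the crux is an implication whose conclusion is the summit, so its negation is the
conjunction of its hypothesis with `¬ABC`. In particular ABC implies the crux and no refutation of the crux exists
short of a refutation of ABC. [folklore] -/
theorem not_compactBalanceTransfer_iff :
    ¬ CompactBalanceTransfer ↔
      ((∀ κ : ℝ, 0 < κ → ∀ ε : ℝ, 0 < ε → ∃ C : ℝ, ∀ a b c : ℕ, IsABCTriple a b c →
          κ * (c : ℝ) ≤ (a : ℝ) → κ * (c : ℝ) ≤ (b : ℝ) → (c : ℝ) < C * ((rad a b c : ℕ) : ℝ) ^ (1 + ε))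
        ∧ ¬ _root_.ABC) :=
  Classical.not_imp

/-- abc on the cell `min(a,b) ≥ c/4` (exponent `1 + ε/6`) gives the Szpiro-currency quarter window consumed by the
tree's descent theorem: `(abc)² ≤ c⁶ ≤ |C₀|⁶ · rad^(6+ε)`. [folklore] -/
theorem szpiroQuarter_of_quarterBalanced
    (hQ : ∀ ε : ℝ, 0 < ε → ∃ C : ℝ, ∀ a b c : ℕ, IsABCTriple a b c →
      (1 / 4 : ℝ) * (c : ℝ) ≤ (a : ℝ) → (1 / 4 : ℝ) * (c : ℝ) ≤ (b : ℝ) →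
        (c : ℝ) < C * ((rad a b c : ℕ) : ℝ) ^ (1 + ε)) :
    ∀ ε : ℝ, 0 < ε → ∃ C : ℝ, ∀ a b c : ℕ, IsABCTriple a b c →
      (1 / 4 : ℝ) * (c : ℝ) ≤ (a : ℝ) → (1 / 4 : ℝ) * (c : ℝ) ≤ (b : ℝ) →
        ((a * b * c : ℕ) : ℝ) ^ 2 ≤ C * ((rad a b c : ℕ) : ℝ) ^ (6 + ε) := by
  intro ε hε
  obtain ⟨C₀, hC₀⟩ := hQ (ε / 6) (by positivity)
  refine ⟨|C₀| ^ 6, fun a b c habc ha hb => ?_⟩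
  have hlt := hC₀ a b c habc ha hb
  obtain ⟨_, _, hsum, _⟩ := habc
  set X : ℝ := ((rad a b c : ℕ) : ℝ) ^ (1 + ε / 6) with hX
  have hR0 : (0 : ℝ) ≤ ((rad a b c : ℕ) : ℝ) := Nat.cast_nonneg _
  have hX0 : 0 ≤ X := Real.rpow_nonneg hR0 _
  have hc0 : (0 : ℝ) ≤ (c : ℝ) := Nat.cast_nonneg _
  have hcle : (c : ℝ) ≤ |C₀| * X := by
    have : C₀ * X ≤ |C₀| * X := mul_le_mul_of_nonneg_right (le_abs_self C₀) hX0
    linarith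
  have habc_le : ((a * b * c : ℕ) : ℝ) ≤ (c : ℝ) ^ 3 := by
    have : a * b * c ≤ c * c * c := by gcongr <;> omega
    calc ((a * b * c : ℕ) : ℝ) ≤ ((c * c * c : ℕ) : ℝ) := by exact_mod_cast this
      _ = (c : ℝ) ^ 3 := by push_cast; ring
  have h0abc : (0 : ℝ) ≤ ((a * b * c : ℕ) : ℝ) := Nat.cast_nonneg _
  have hsq : ((a * b * c : ℕ) : ℝ) ^ 2 ≤ ((c : ℝ) ^ 3) ^ 2 := pow_le_pow_left₀ h0abc habc_le 2
  have hpow6 : (c : ℝ) ^ 6 ≤ (|C₀| * X) ^ 6 := pow_le_pow_left₀ hc0 hcle 6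
  have hX6 : X ^ 6 = ((rad a b c : ℕ) : ℝ) ^ (6 + ε) := by
    rw [hX, ← Real.rpow_natCast, ← Real.rpow_mul hR0]
    norm_num
    ring_nf
  calc ((a * b * c : ℕ) : ℝ) ^ 2 ≤ ((c : ℝ) ^ 3) ^ 2 := hsq
    _ = (c : ℝ) ^ 6 := by ring
    _ ≤ (|C₀| * X) ^ 6 := hpow6
    _ = |C₀| ^ 6 * X ^ 6 := by ring
    _ = |C₀| ^ 6 * ((rad a b c : ℕ) : ℝ) ^ (6 + ε) := by rw [hX6]

/-- **The `∀ κ` of the crux hypothesis is spurious.** The crux together with abc on the SINGLE cell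
`min(a,b) ≥ c/4` already gives `ABC`: the quarter-window bound yields the Szpiro-currency quarter window
(`szpiroQuarter_of_quarterBalanced`), the tree's squaring descent `quarterWindowGivesCrux_proof` turns it into
`BalancedFreySzpiro`, the currency change `balancedABC_of_balancedFreySzpiro` into the full hypothesis `H`, and the
crux into `ABC`. [folklore] -/
theorem abc_of_quarterBalanced_of_compactBalanceTransfer (hT : CompactBalanceTransfer)
    (hQ : ∀ ε : ℝ, 0 < ε → ∃ C : ℝ, ∀ a b c : ℕ, IsABCTriple a b c →
      (1 / 4 : ℝ) * (c : ℝ) ≤ (a : ℝ) → (1 / 4 : ℝ) * (c : ℝ) ≤ (b : ℝ) →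
        (c : ℝ) < C * ((rad a b c : ℕ) : ℝ) ^ (1 + ε)) : _root_.ABC :=
  hT (Summit.ABC.ABC.Theorems.balancedABC_of_balancedFreySzpiro
    (Summit.ABC.ABC.Theorems.quarterWindowGivesCrux_proof (szpiroQuarter_of_quarterBalanced hQ)))

/-- **Negative form of the single-balance reduction**: `¬ crux ↔ (abc holds on the cell min(a,b) ≥ c/4) ∧ ¬ABC`.
So a disproof of the crux must produce abc on the quarter cell AND a counterexample to abc; and a proof of the crux
is exactly a proof of "abc on the cell `min(a,b) ≥ c/4` implies abc". [folklore] -/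
theorem not_compactBalanceTransfer_iff_quarter :
    ¬ CompactBalanceTransfer ↔
      ((∀ ε : ℝ, 0 < ε → ∃ C : ℝ, ∀ a b c : ℕ, IsABCTriple a b c →
          (1 / 4 : ℝ) * (c : ℝ) ≤ (a : ℝ) → (1 / 4 : ℝ) * (c : ℝ) ≤ (b : ℝ) →
            (c : ℝ) < C * ((rad a b c : ℕ) : ℝ) ^ (1 + ε))
        ∧ ¬ _root_.ABC) := by
  constructor
  · intro h
    obtain ⟨hH, hA⟩ := not_compactBalanceTransfer_iff.mp h
    exact ⟨fun ε hε => hH (1 / 4) (by norm_num) ε hε, hA⟩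
  · rintro ⟨hQ, hA⟩ hT
    exact hA (abc_of_quarterBalanced_of_compactBalanceTransfer hT hQ)

end Summit.ABC.ABC.Theorems.CompactBalanceTransfer.Negative
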